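import Literature.NumberTheory.Transcendental.UnivExtTheta
import Literature.NumberTheory.EllipticCurves.RealLatticePeriodHalfPeriodsProofs
import HarnessLib

/-!
# Derivatives of the blocks `P_i`, `Z_i` of `E♮` and the block Wronskian identities

Topic: `Literature/NumberTheory/Transcendental`. A brick for the theta-model instance of the
abstract zero estimate (`ZeroEstModel.lean`, field `wronsk` of `AnalyticGroupModel`:
`Θ_J ∂_xΘ_I - Θ_I ∂_xΘ_J` is a QUADRATIC FORM in `Θ`). The theta functions of `M_κ` are built from
the entire blocks `P_i = σ³(1, ℘, ℘′)`, `Z_i = σ³(ζ, ℘ζ, ℘′ζ + 2℘²)` of `UnivExtTheta.lean`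
(polynomials in the sigma jets `σ, σ′, σ″, σ‴` of `SigmaJets.lean`); a derivative along an
`E`-coordinate `z'_b` only touches block `b`, where the Wronskian of two theta functions reduces
(`PkappaThetaWronskian.lean`) to the four one-variable combinations
`P_jP_i′ - P_iP_j′`, `P_jZ_i′ - P_j′Z_i`, `Z_jZ_i′ - Z_iZ_j′` of the blocks. PROVED here:

* `PeriodPair.sigmaDeriv_four_eq` — `σ⁗ = σ(ζ⁴ - 6ζ²℘ - 4ζ℘′ - 3℘² + g₂/2)` off the lattice
  (equivalently the bilinear ODE `σσ⁗ - 4σ′σ‴ + 3σ″² = (g₂/2)σ²`);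
* `PeriodPair.univExtP'`, `PeriodPair.univExtZ'` — the derivatives of the blocks as polynomials in
  the jets `σ, …, σ⁗` (`hasDerivAt_univExtP`, `hasDerivAt_univExtZ`), and their values off the
  lattice (`univExtP'_eq`: `P₀′ = 3Z₀`, `P₁′ = 3Z₁ + P₂`, `P₂′ = 3Z₂ - (g₂/2)P₀` in closed form;
  `univExtZ'_eq`);
* **the 27 block Wronskian identities** `PeriodPair.wronskP_ij`, `wronskPZ_ij`, `wronskZ_ij`
  (`i, j ∈ Fin 3`), off the lattice: each Wronskian combination is an explicit quadratic expression
  in the `P_l`, `Z_l` with coefficients in `ℚ[g₂, g₃]` (tables `ω`, `r`, `t` of the module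
  `PkappaThetaWronskian.lean`; e.g. `P₁P₂′ - P₂P₁′ = ½P₂² + g₂P₀P₁ + (3/2)g₃P₀²`,
  `P₂Z₂′ - P₂′Z₂ = -(2g₂P₁² + 3g₃P₀P₁)`). Proof: substitute the jets (`ζ², ζ³, ζ⁴` cancel
  identically) and use `℘′² = 4℘³ - g₂℘ - g₃` with an explicit cofactor (found and checked by a
  computer algebra computation, certificate = the `linear_combination` coefficient).

## References

* E. T. Whittaker, G. N. Watson, *A Course of Modern Analysis*, 4th ed., CUP 1927, §20.2–20.22,
  §20.4–20.421 (`σ, ζ, ℘` and their differential equations). [WhittakerWatson1927]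
* Yu. V. Nesterenko, P. Philippon (eds.), *Introduction to Algebraic Independence Theory*,
  LNM 1752, Springer 2001, Ch. 11 (D. Roy), Lemma 3.1 (derivatives of regular functions are
  regular). [NesterenkoPhilippon2001]
-/

noncomputable section

open Complex Filter Topology
open scoped PeriodPair

namespace Literature.NumberTheory.Transcendental

variable (L : PeriodPair)

/-! ### The fourth sigma jet off the lattice -/

variable {L} in
/-- `σ‴ = σ(ζ³ - 3ζ℘ - ℘′)` as an identity of functions near every point off the lattice. [folklore] -/
theorem _root_.PeriodPair.sigmaDeriv_three_eventuallyEq {z : ℂ} (hz : z ∉ L.lattice) :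
    L.sigmaDeriv 3 =ᶠ[𝓝 z] fun w =>
      L.weierstrassSigma w * (L.weierstrassZeta w ^ 3 - 3 * L.weierstrassZeta w * ℘[L] w - ℘'[L] w) := by
  filter_upwards [L.isClosed_lattice.isOpen_compl.mem_nhds hz] with w hw
  exact L.sigmaDeriv_three_eq hw

/-- **`σ⁗ = σ(ζ⁴ - 6ζ²℘ - 4ζ℘′ - 3℘² + g₂/2)` off the lattice** (differentiate `σ‴`, using
`σ′ = σζ`, `ζ′ = -℘`, `℘″ = 6℘² - g₂/2`). [cite: WhittakerWatson1927, §20.421] -/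
theorem _root_.PeriodPair.sigmaDeriv_four_eq {z : ℂ} (hz : z ∉ L.lattice) :
    L.sigmaDeriv 4 z =
      L.weierstrassSigma z * (L.weierstrassZeta z ^ 4 - 6 * L.weierstrassZeta z ^ 2 * ℘[L] z -
        4 * L.weierstrassZeta z * ℘'[L] z - 3 * ℘[L] z ^ 2 + L.g₂ / 2) := by
  have hσ : HasDerivAt L.weierstrassSigma (L.sigmaDeriv 1 z) z := by
    simpa using L.hasDerivAt_sigmaDeriv 0 z
  have hζ := PeriodPair.hasDerivAt_weierstrassZeta hz
  have hP := PeriodPair.hasDerivAt_weierstrassP hz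
  have hP' := L.hasDerivAt_derivWeierstrassP hz
  have h1 : HasDerivAt (fun w => L.weierstrassSigma w *
      (L.weierstrassZeta w ^ 3 - 3 * L.weierstrassZeta w * ℘[L] w - ℘'[L] w)) _ z :=
    hσ.fun_mul (((hζ.fun_pow 3).fun_sub ((hζ.const_mul 3).fun_mul hP)).fun_sub hP')
  have h4 : L.sigmaDeriv 4 = deriv (L.sigmaDeriv 3) := PeriodPair.sigmaDeriv_succ (L := L) 3
  rw [h4, (PeriodPair.sigmaDeriv_three_eventuallyEq hz).deriv_eq, h1.deriv, L.sigmaDeriv_one_eq hz]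
  push_cast
  ring

/-! ### The derivatives of the blocks -/

/-- **`P′` as polynomials in the jets**: `P₀′ = 3σ²σ′`, `P₁′ = σ′³ - σ²σ‴`,
`P₂′ = -3σ′²σ″ + 3σσ″² + σσ′σ‴ - σ²σ⁗`. [folklore] -/
def _root_.PeriodPair.univExtP' (i : Fin 3) (z : ℂ) : ℂ :=
  ![3 * L.sigmaDeriv 0 z ^ 2 * L.sigmaDeriv 1 z,
    L.sigmaDeriv 1 z ^ 3 - L.sigmaDeriv 0 z ^ 2 * L.sigmaDeriv 3 z,
    -3 * L.sigmaDeriv 1 z ^ 2 * L.sigmaDeriv 2 z + 3 * L.sigmaDeriv 0 z * L.sigmaDeriv 2 z ^ 2 +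
      L.sigmaDeriv 0 z * L.sigmaDeriv 1 z * L.sigmaDeriv 3 z - L.sigmaDeriv 0 z ^ 2 * L.sigmaDeriv 4 z] i

/-- **`Z′` as polynomials in the jets**: `Z₀′ = 2σσ′² + σ²σ″`, `Z₁′ = 2σ′²σ″ - σσ″² - σσ′σ‴`,
`Z₂′ = -2σ′²σ‴ + 3σσ″σ‴ - σσ′σ⁗`. [folklore] -/
def _root_.PeriodPair.univExtZ' (i : Fin 3) (z : ℂ) : ℂ :=
  ![2 * L.sigmaDeriv 0 z * L.sigmaDeriv 1 z ^ 2 + L.sigmaDeriv 0 z ^ 2 * L.sigmaDeriv 2 z,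
    2 * L.sigmaDeriv 1 z ^ 2 * L.sigmaDeriv 2 z - L.sigmaDeriv 0 z * L.sigmaDeriv 2 z ^ 2 -
      L.sigmaDeriv 0 z * L.sigmaDeriv 1 z * L.sigmaDeriv 3 z,
    -2 * L.sigmaDeriv 1 z ^ 2 * L.sigmaDeriv 3 z + 3 * L.sigmaDeriv 0 z * L.sigmaDeriv 2 z * L.sigmaDeriv 3 z -
      L.sigmaDeriv 0 z * L.sigmaDeriv 1 z * L.sigmaDeriv 4 z] i

/-- `P₀′`. [folklore] -/
theorem _root_.PeriodPair.univExtP'_zero (z : ℂ) :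
    L.univExtP' 0 z = 3 * L.sigmaDeriv 0 z ^ 2 * L.sigmaDeriv 1 z := rfl

/-- `P₁′`. [folklore] -/
theorem _root_.PeriodPair.univExtP'_one (z : ℂ) :
    L.univExtP' 1 z = L.sigmaDeriv 1 z ^ 3 - L.sigmaDeriv 0 z ^ 2 * L.sigmaDeriv 3 z := rfl

/-- `P₂′`. [folklore] -/
theorem _root_.PeriodPair.univExtP'_two (z : ℂ) :
    L.univExtP' 2 z = -3 * L.sigmaDeriv 1 z ^ 2 * L.sigmaDeriv 2 z + 3 * L.sigmaDeriv 0 z * L.sigmaDeriv 2 z ^ 2 +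
      L.sigmaDeriv 0 z * L.sigmaDeriv 1 z * L.sigmaDeriv 3 z - L.sigmaDeriv 0 z ^ 2 * L.sigmaDeriv 4 z := rfl

/-- `Z₀′`. [folklore] -/
theorem _root_.PeriodPair.univExtZ'_zero (z : ℂ) :
    L.univExtZ' 0 z = 2 * L.sigmaDeriv 0 z * L.sigmaDeriv 1 z ^ 2 + L.sigmaDeriv 0 z ^ 2 * L.sigmaDeriv 2 z := rfl

/-- `Z₁′`. [folklore] -/
theorem _root_.PeriodPair.univExtZ'_one (z : ℂ) :
    L.univExtZ' 1 z = 2 * L.sigmaDeriv 1 z ^ 2 * L.sigmaDeriv 2 z - L.sigmaDeriv 0 z * L.sigmaDeriv 2 z ^ 2 -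
      L.sigmaDeriv 0 z * L.sigmaDeriv 1 z * L.sigmaDeriv 3 z := rfl

/-- `Z₂′`. [folklore] -/
theorem _root_.PeriodPair.univExtZ'_two (z : ℂ) :
    L.univExtZ' 2 z = -2 * L.sigmaDeriv 1 z ^ 2 * L.sigmaDeriv 3 z +
      3 * L.sigmaDeriv 0 z * L.sigmaDeriv 2 z * L.sigmaDeriv 3 z -
        L.sigmaDeriv 0 z * L.sigmaDeriv 1 z * L.sigmaDeriv 4 z := rfl

/-- `P₀′ = univExtP' 0`. [folklore] -/
theorem _root_.PeriodPair.hasDerivAt_univExtP_zero (z : ℂ) : HasDerivAt (L.univExtP 0) (L.univExtP' 0 z) z := by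
  have h0 := L.hasDerivAt_sigmaDeriv 0 z
  have hf : L.univExtP 0 = fun z => L.sigmaDeriv 0 z ^ 3 := funext fun z => L.univExtP_zero z
  rw [hf]
  exact (h0.fun_pow 3).congr_deriv (by rw [PeriodPair.univExtP'_zero]; push_cast; ring)

/-- `P₁′ = univExtP' 1`. [folklore] -/
theorem _root_.PeriodPair.hasDerivAt_univExtP_one (z : ℂ) : HasDerivAt (L.univExtP 1) (L.univExtP' 1 z) z := by
  have h0 := L.hasDerivAt_sigmaDeriv 0 z
  have h1 := L.hasDerivAt_sigmaDeriv 1 z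
  have h2 := L.hasDerivAt_sigmaDeriv 2 z
  have hf : L.univExtP 1 = fun z => L.sigmaDeriv 0 z * (L.sigmaDeriv 1 z ^ 2 - L.sigmaDeriv 0 z * L.sigmaDeriv 2 z) :=
    funext fun z => L.univExtP_one z
  rw [hf]
  exact (h0.fun_mul ((h1.fun_pow 2).fun_sub (h0.fun_mul h2))).congr_deriv
    (by rw [PeriodPair.univExtP'_one]; push_cast; ring)

/-- `P₂′ = univExtP' 2`. [folklore] -/
theorem _root_.PeriodPair.hasDerivAt_univExtP_two (z : ℂ) : HasDerivAt (L.univExtP 2) (L.univExtP' 2 z) z := by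
  have h0 := L.hasDerivAt_sigmaDeriv 0 z
  have h1 := L.hasDerivAt_sigmaDeriv 1 z
  have h2 := L.hasDerivAt_sigmaDeriv 2 z
  have h3 := L.hasDerivAt_sigmaDeriv 3 z
  have hf : L.univExtP 2 = fun z => 3 * L.sigmaDeriv 0 z * L.sigmaDeriv 1 z * L.sigmaDeriv 2 z -
      2 * L.sigmaDeriv 1 z ^ 3 - L.sigmaDeriv 0 z ^ 2 * L.sigmaDeriv 3 z := funext fun z => L.univExtP_two z
  rw [hf]
  exact (((((h0.const_mul 3).fun_mul h1).fun_mul h2).fun_sub ((h1.fun_pow 3).const_mul 2)).fun_sub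
    ((h0.fun_pow 2).fun_mul h3)).congr_deriv (by rw [PeriodPair.univExtP'_two]; push_cast; ring)

/-- **`P_i′ = univExtP' i`.** [folklore] -/
theorem _root_.PeriodPair.hasDerivAt_univExtP (i : Fin 3) (z : ℂ) :
    HasDerivAt (L.univExtP i) (L.univExtP' i z) z := by
  fin_cases i
  exacts [L.hasDerivAt_univExtP_zero z, L.hasDerivAt_univExtP_one z, L.hasDerivAt_univExtP_two z]

/-- `Z₀′ = univExtZ' 0`. [folklore] -/
theorem _root_.PeriodPair.hasDerivAt_univExtZ_zero (z : ℂ) : HasDerivAt (L.univExtZ 0) (L.univExtZ' 0 z) z := by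
  have h0 := L.hasDerivAt_sigmaDeriv 0 z
  have h1 := L.hasDerivAt_sigmaDeriv 1 z
  have hf : L.univExtZ 0 = fun z => L.sigmaDeriv 0 z ^ 2 * L.sigmaDeriv 1 z := funext fun z => L.univExtZ_zero z
  rw [hf]
  exact ((h0.fun_pow 2).fun_mul h1).congr_deriv (by rw [PeriodPair.univExtZ'_zero]; push_cast; ring)

/-- `Z₁′ = univExtZ' 1`. [folklore] -/
theorem _root_.PeriodPair.hasDerivAt_univExtZ_one (z : ℂ) : HasDerivAt (L.univExtZ 1) (L.univExtZ' 1 z) z := by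
  have h0 := L.hasDerivAt_sigmaDeriv 0 z
  have h1 := L.hasDerivAt_sigmaDeriv 1 z
  have h2 := L.hasDerivAt_sigmaDeriv 2 z
  have hf : L.univExtZ 1 = fun z => L.sigmaDeriv 1 z ^ 3 - L.sigmaDeriv 0 z * L.sigmaDeriv 1 z * L.sigmaDeriv 2 z :=
    funext fun z => L.univExtZ_one z
  rw [hf]
  exact ((h1.fun_pow 3).fun_sub ((h0.fun_mul h1).fun_mul h2)).congr_deriv
    (by rw [PeriodPair.univExtZ'_one]; push_cast; ring)

/-- `Z₂′ = univExtZ' 2`. [folklore] -/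
theorem _root_.PeriodPair.hasDerivAt_univExtZ_two (z : ℂ) : HasDerivAt (L.univExtZ 2) (L.univExtZ' 2 z) z := by
  have h0 := L.hasDerivAt_sigmaDeriv 0 z
  have h1 := L.hasDerivAt_sigmaDeriv 1 z
  have h2 := L.hasDerivAt_sigmaDeriv 2 z
  have h3 := L.hasDerivAt_sigmaDeriv 3 z
  have hf : L.univExtZ 2 = fun z => -(L.sigmaDeriv 1 z ^ 2 * L.sigmaDeriv 2 z) -
      L.sigmaDeriv 0 z * L.sigmaDeriv 1 z * L.sigmaDeriv 3 z + 2 * L.sigmaDeriv 0 z * L.sigmaDeriv 2 z ^ 2 :=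
    funext fun z => L.univExtZ_two z
  rw [hf]
  exact ((((h1.fun_pow 2).fun_mul h2).fun_neg.fun_sub ((h0.fun_mul h1).fun_mul h3)).fun_add
    ((h0.const_mul 2).fun_mul (h2.fun_pow 2))).congr_deriv (by rw [PeriodPair.univExtZ'_two]; push_cast; ring)

/-- **`Z_i′ = univExtZ' i`.** [folklore] -/
theorem _root_.PeriodPair.hasDerivAt_univExtZ (i : Fin 3) (z : ℂ) :
    HasDerivAt (L.univExtZ i) (L.univExtZ' i z) z := by
  fin_cases i
  exacts [L.hasDerivAt_univExtZ_zero z, L.hasDerivAt_univExtZ_one z, L.hasDerivAt_univExtZ_two z]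

/-- **`P′` off the lattice**: `P₀′ = 3σ³ζ`, `P₁′ = σ³(℘′ + 3ζ℘)`, `P₂′ = σ³(6℘² - g₂/2 + 3ζ℘′)`
(so `P₀′ = 3Z₀`, `P₁′ = 3Z₁ + P₂`, `P₂′ = 3Z₂ - (g₂/2)P₀`). [folklore] -/
theorem _root_.PeriodPair.univExtP'_eq {z : ℂ} (hz : z ∉ L.lattice) :
    L.univExtP' 0 z = 3 * L.weierstrassSigma z ^ 3 * L.weierstrassZeta z ∧
    L.univExtP' 1 z = L.weierstrassSigma z ^ 3 * ℘'[L] z + 3 * L.weierstrassSigma z ^ 3 * L.weierstrassZeta z * ℘[L] z ∧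
    L.univExtP' 2 z = (-1 / 2 : ℂ) * L.weierstrassSigma z ^ 3 * L.g₂ + 6 * L.weierstrassSigma z ^ 3 * ℘[L] z ^ 2 +
      3 * L.weierstrassSigma z ^ 3 * L.weierstrassZeta z * ℘'[L] z := by
  simp only [PeriodPair.univExtP'_zero, PeriodPair.univExtP'_one, PeriodPair.univExtP'_two,
    PeriodPair.sigmaDeriv_zero_eq, L.sigmaDeriv_one_eq hz, L.sigmaDeriv_two_eq hz, L.sigmaDeriv_three_eq hz,
    L.sigmaDeriv_four_eq hz]
  exact ⟨by ring, by ring, by ring⟩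

/-- **`Z′` off the lattice**: `Z₀′ = σ³(3ζ² - ℘)`, `Z₁′ = σ³(3ζ²℘ + ζ℘′ - ℘²)`,
`Z₂′ = σ³(3ζ²℘′ + 12ζ℘² + 3℘℘′ - (g₂/2)ζ)`. [folklore] -/
theorem _root_.PeriodPair.univExtZ'_eq {z : ℂ} (hz : z ∉ L.lattice) :
    L.univExtZ' 0 z = -(L.weierstrassSigma z ^ 3 * ℘[L] z) + 3 * L.weierstrassSigma z ^ 3 * L.weierstrassZeta z ^ 2 ∧
    L.univExtZ' 1 z = -(L.weierstrassSigma z ^ 3 * ℘[L] z ^ 2) + L.weierstrassSigma z ^ 3 * L.weierstrassZeta z * ℘'[L] z +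
      3 * L.weierstrassSigma z ^ 3 * L.weierstrassZeta z ^ 2 * ℘[L] z ∧
    L.univExtZ' 2 z = 3 * L.weierstrassSigma z ^ 3 * ℘[L] z * ℘'[L] z +
      (-1 / 2 : ℂ) * L.weierstrassSigma z ^ 3 * L.weierstrassZeta z * L.g₂ +
        12 * L.weierstrassSigma z ^ 3 * L.weierstrassZeta z * ℘[L] z ^ 2 +
          3 * L.weierstrassSigma z ^ 3 * L.weierstrassZeta z ^ 2 * ℘'[L] z := by
  simp only [PeriodPair.univExtZ'_zero, PeriodPair.univExtZ'_one, PeriodPair.univExtZ'_two,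
    PeriodPair.sigmaDeriv_zero_eq, L.sigmaDeriv_one_eq hz, L.sigmaDeriv_two_eq hz, L.sigmaDeriv_three_eq hz,
    L.sigmaDeriv_four_eq hz]
  exact ⟨by ring, by ring, by ring⟩

/-! ### The block Wronskian identities -/

/-- The block Wronskian identity `P_j P_i′ - P_i P_j′` for `(i, j) = (0, 0)`, off the lattice. [folklore] -/
theorem _root_.PeriodPair.wronskP_00 {z : ℂ} (hz : z ∉ L.lattice) :
    L.univExtP 0 z * L.univExtP' 0 z - L.univExtP 0 z * L.univExtP' 0 z =
      0 := by
  obtain ⟨p0, -, -⟩ := L.univExtP_eq hz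
  obtain ⟨d0, -, -⟩ := L.univExtP'_eq hz
  have hsq := L.derivWeierstrassP_sq z hz
  set S := L.weierstrassSigma z
  set T := L.weierstrassZeta z
  set WP := ℘[L] z
  set WQ := ℘'[L] z
  rw [p0, d0]
  linear_combination (0) * hsq


/-- The block Wronskian identity `P_j P_i′ - P_i P_j′` for `(i, j) = (0, 1)`, off the lattice. [folklore] -/
theorem _root_.PeriodPair.wronskP_01 {z : ℂ} (hz : z ∉ L.lattice) :
    L.univExtP 1 z * L.univExtP' 0 z - L.univExtP 0 z * L.univExtP' 1 z =
      ((-1 / 2 : ℂ)) * (L.univExtP 0 z * L.univExtP 2 z) + ((-1 / 2 : ℂ)) * (L.univExtP 2 z * L.univExtP 0 z) := by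
  obtain ⟨p0, p1, p2⟩ := L.univExtP_eq hz
  obtain ⟨d0, d1, -⟩ := L.univExtP'_eq hz
  have hsq := L.derivWeierstrassP_sq z hz
  set S := L.weierstrassSigma z
  set T := L.weierstrassZeta z
  set WP := ℘[L] z
  set WQ := ℘'[L] z
  rw [p0, p1, p2, d0, d1]
  linear_combination (0) * hsq


/-- The block Wronskian identity `P_j P_i′ - P_i P_j′` for `(i, j) = (0, 2)`, off the lattice. [folklore] -/
theorem _root_.PeriodPair.wronskP_02 {z : ℂ} (hz : z ∉ L.lattice) :
    L.univExtP 2 z * L.univExtP' 0 z - L.univExtP 0 z * L.univExtP' 2 z =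
      ((1 / 2 : ℂ) * L.g₂) * (L.univExtP 0 z * L.univExtP 0 z) + ((-6 : ℂ)) * (L.univExtP 1 z * L.univExtP 1 z) := by
  obtain ⟨p0, p1, p2⟩ := L.univExtP_eq hz
  obtain ⟨d0, -, d2⟩ := L.univExtP'_eq hz
  have hsq := L.derivWeierstrassP_sq z hz
  set S := L.weierstrassSigma z
  set T := L.weierstrassZeta z
  set WP := ℘[L] z
  set WQ := ℘'[L] z
  rw [p0, p1, p2, d0, d2]
  linear_combination (0) * hsq


/-- The block Wronskian identity `P_j P_i′ - P_i P_j′` for `(i, j) = (1, 0)`, off the lattice. [folklore] -/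
theorem _root_.PeriodPair.wronskP_10 {z : ℂ} (hz : z ∉ L.lattice) :
    L.univExtP 0 z * L.univExtP' 1 z - L.univExtP 1 z * L.univExtP' 0 z =
      ((1 / 2 : ℂ)) * (L.univExtP 0 z * L.univExtP 2 z) + ((1 / 2 : ℂ)) * (L.univExtP 2 z * L.univExtP 0 z) := by
  obtain ⟨p0, p1, p2⟩ := L.univExtP_eq hz
  obtain ⟨d0, d1, -⟩ := L.univExtP'_eq hz
  have hsq := L.derivWeierstrassP_sq z hz
  set S := L.weierstrassSigma z
  set T := L.weierstrassZeta z
  set WP := ℘[L] z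
  set WQ := ℘'[L] z
  rw [p0, p1, p2, d0, d1]
  linear_combination (0) * hsq


/-- The block Wronskian identity `P_j P_i′ - P_i P_j′` for `(i, j) = (1, 1)`, off the lattice. [folklore] -/
theorem _root_.PeriodPair.wronskP_11 {z : ℂ} (hz : z ∉ L.lattice) :
    L.univExtP 1 z * L.univExtP' 1 z - L.univExtP 1 z * L.univExtP' 1 z =
      0 := by
  obtain ⟨-, p1, -⟩ := L.univExtP_eq hz
  obtain ⟨-, d1, -⟩ := L.univExtP'_eq hz
  have hsq := L.derivWeierstrassP_sq z hz
  set S := L.weierstrassSigma z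
  set T := L.weierstrassZeta z
  set WP := ℘[L] z
  set WQ := ℘'[L] z
  rw [p1, d1]
  linear_combination (0) * hsq


/-- The block Wronskian identity `P_j P_i′ - P_i P_j′` for `(i, j) = (1, 2)`, off the lattice. [folklore] -/
theorem _root_.PeriodPair.wronskP_12 {z : ℂ} (hz : z ∉ L.lattice) :
    L.univExtP 2 z * L.univExtP' 1 z - L.univExtP 1 z * L.univExtP' 2 z =
      ((-3 / 2 : ℂ) * L.g₃) * (L.univExtP 0 z * L.univExtP 0 z) + ((-1 / 2 : ℂ) * L.g₂) * (L.univExtP 0 z * L.univExtP 1 z) + ((-1 / 2 : ℂ) * L.g₂) * (L.univExtP 1 z * L.univExtP 0 z) + ((-1 / 2 : ℂ)) * (L.univExtP 2 z * L.univExtP 2 z) := by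
  obtain ⟨p0, p1, p2⟩ := L.univExtP_eq hz
  obtain ⟨-, d1, d2⟩ := L.univExtP'_eq hz
  have hsq := L.derivWeierstrassP_sq z hz
  set S := L.weierstrassSigma z
  set T := L.weierstrassZeta z
  set WP := ℘[L] z
  set WQ := ℘'[L] z
  rw [p0, p1, p2, d1, d2]
  linear_combination ((3 / 2 : ℂ) * S ^ 6) * hsq


/-- The block Wronskian identity `P_j P_i′ - P_i P_j′` for `(i, j) = (2, 0)`, off the lattice. [folklore] -/
theorem _root_.PeriodPair.wronskP_20 {z : ℂ} (hz : z ∉ L.lattice) :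
    L.univExtP 0 z * L.univExtP' 2 z - L.univExtP 2 z * L.univExtP' 0 z =
      ((-1 / 2 : ℂ) * L.g₂) * (L.univExtP 0 z * L.univExtP 0 z) + ((6 : ℂ)) * (L.univExtP 1 z * L.univExtP 1 z) := by
  obtain ⟨p0, p1, p2⟩ := L.univExtP_eq hz
  obtain ⟨d0, -, d2⟩ := L.univExtP'_eq hz
  have hsq := L.derivWeierstrassP_sq z hz
  set S := L.weierstrassSigma z
  set T := L.weierstrassZeta z
  set WP := ℘[L] z
  set WQ := ℘'[L] z
  rw [p0, p1, p2, d0, d2]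
  linear_combination (0) * hsq


/-- The block Wronskian identity `P_j P_i′ - P_i P_j′` for `(i, j) = (2, 1)`, off the lattice. [folklore] -/
theorem _root_.PeriodPair.wronskP_21 {z : ℂ} (hz : z ∉ L.lattice) :
    L.univExtP 1 z * L.univExtP' 2 z - L.univExtP 2 z * L.univExtP' 1 z =
      ((3 / 2 : ℂ) * L.g₃) * (L.univExtP 0 z * L.univExtP 0 z) + ((1 / 2 : ℂ) * L.g₂) * (L.univExtP 0 z * L.univExtP 1 z) + ((1 / 2 : ℂ) * L.g₂) * (L.univExtP 1 z * L.univExtP 0 z) + ((1 / 2 : ℂ)) * (L.univExtP 2 z * L.univExtP 2 z) := by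
  obtain ⟨p0, p1, p2⟩ := L.univExtP_eq hz
  obtain ⟨-, d1, d2⟩ := L.univExtP'_eq hz
  have hsq := L.derivWeierstrassP_sq z hz
  set S := L.weierstrassSigma z
  set T := L.weierstrassZeta z
  set WP := ℘[L] z
  set WQ := ℘'[L] z
  rw [p0, p1, p2, d1, d2]
  linear_combination ((-3 / 2 : ℂ) * S ^ 6) * hsq


/-- The block Wronskian identity `P_j P_i′ - P_i P_j′` for `(i, j) = (2, 2)`, off the lattice. [folklore] -/
theorem _root_.PeriodPair.wronskP_22 {z : ℂ} (hz : z ∉ L.lattice) :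
    L.univExtP 2 z * L.univExtP' 2 z - L.univExtP 2 z * L.univExtP' 2 z =
      0 := by
  obtain ⟨-, -, p2⟩ := L.univExtP_eq hz
  obtain ⟨-, -, d2⟩ := L.univExtP'_eq hz
  have hsq := L.derivWeierstrassP_sq z hz
  set S := L.weierstrassSigma z
  set T := L.weierstrassZeta z
  set WP := ℘[L] z
  set WQ := ℘'[L] z
  rw [p2, d2]
  linear_combination (0) * hsq


/-- The block Wronskian identity `P_j Z_i′ - P_j′ Z_i` for `(i, j) = (0, 0)`, off the lattice. [folklore] -/
theorem _root_.PeriodPair.wronskPZ_00 {z : ℂ} (hz : z ∉ L.lattice) :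
    L.univExtP 0 z * L.univExtZ' 0 z - L.univExtP' 0 z * L.univExtZ 0 z =
      -(((1 : ℂ)) * (L.univExtP 0 z * L.univExtP 1 z)) := by
  obtain ⟨p0, p1, -⟩ := L.univExtP_eq hz
  obtain ⟨z0, -, -⟩ := L.univExtZ_eq hz
  obtain ⟨d0, -, -⟩ := L.univExtP'_eq hz
  obtain ⟨e0, -, -⟩ := L.univExtZ'_eq hz
  have hsq := L.derivWeierstrassP_sq z hz
  set S := L.weierstrassSigma z
  set T := L.weierstrassZeta z
  set WP := ℘[L] z
  set WQ := ℘'[L] z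
  rw [p0, p1, z0, d0, e0]
  linear_combination (0) * hsq


/-- The block Wronskian identity `P_j Z_i′ - P_j′ Z_i` for `(i, j) = (0, 1)`, off the lattice. [folklore] -/
theorem _root_.PeriodPair.wronskPZ_01 {z : ℂ} (hz : z ∉ L.lattice) :
    L.univExtP 1 z * L.univExtZ' 0 z - L.univExtP' 1 z * L.univExtZ 0 z =
      ((-1 / 2 : ℂ)) * (L.univExtZ 0 z * L.univExtP 2 z) + ((-1 / 2 : ℂ)) * (L.univExtZ 2 z * L.univExtP 0 z) := by
  obtain ⟨p0, p1, p2⟩ := L.univExtP_eq hz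
  obtain ⟨z0, -, z2⟩ := L.univExtZ_eq hz
  obtain ⟨-, d1, -⟩ := L.univExtP'_eq hz
  obtain ⟨e0, -, -⟩ := L.univExtZ'_eq hz
  have hsq := L.derivWeierstrassP_sq z hz
  set S := L.weierstrassSigma z
  set T := L.weierstrassZeta z
  set WP := ℘[L] z
  set WQ := ℘'[L] z
  rw [p0, p1, p2, z0, z2, d1, e0]
  linear_combination (0) * hsq


/-- The block Wronskian identity `P_j Z_i′ - P_j′ Z_i` for `(i, j) = (0, 2)`, off the lattice. [folklore] -/
theorem _root_.PeriodPair.wronskPZ_02 {z : ℂ} (hz : z ∉ L.lattice) :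
    L.univExtP 2 z * L.univExtZ' 0 z - L.univExtP' 2 z * L.univExtZ 0 z =
      ((1 / 2 : ℂ) * L.g₂) * (L.univExtZ 0 z * L.univExtP 0 z) + ((-6 : ℂ)) * (L.univExtZ 1 z * L.univExtP 1 z) + -(((1 : ℂ)) * (L.univExtP 1 z * L.univExtP 2 z)) := by
  obtain ⟨p0, p1, p2⟩ := L.univExtP_eq hz
  obtain ⟨z0, z1, -⟩ := L.univExtZ_eq hz
  obtain ⟨-, -, d2⟩ := L.univExtP'_eq hz
  obtain ⟨e0, -, -⟩ := L.univExtZ'_eq hz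
  have hsq := L.derivWeierstrassP_sq z hz
  set S := L.weierstrassSigma z
  set T := L.weierstrassZeta z
  set WP := ℘[L] z
  set WQ := ℘'[L] z
  rw [p0, p1, p2, z0, z1, d2, e0]
  linear_combination (0) * hsq


/-- The block Wronskian identity `P_j Z_i′ - P_j′ Z_i` for `(i, j) = (1, 0)`, off the lattice. [folklore] -/
theorem _root_.PeriodPair.wronskPZ_10 {z : ℂ} (hz : z ∉ L.lattice) :
    L.univExtP 0 z * L.univExtZ' 1 z - L.univExtP' 0 z * L.univExtZ 1 z =
      ((1 / 2 : ℂ)) * (L.univExtZ 0 z * L.univExtP 2 z) + ((1 / 2 : ℂ)) * (L.univExtZ 2 z * L.univExtP 0 z) + -(((2 : ℂ)) * (L.univExtP 1 z * L.univExtP 1 z)) := by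
  obtain ⟨p0, p1, p2⟩ := L.univExtP_eq hz
  obtain ⟨z0, z1, z2⟩ := L.univExtZ_eq hz
  obtain ⟨d0, -, -⟩ := L.univExtP'_eq hz
  obtain ⟨-, e1, -⟩ := L.univExtZ'_eq hz
  have hsq := L.derivWeierstrassP_sq z hz
  set S := L.weierstrassSigma z
  set T := L.weierstrassZeta z
  set WP := ℘[L] z
  set WQ := ℘'[L] z
  rw [p0, p1, p2, z0, z1, z2, d0, e1]
  linear_combination (0) * hsq


/-- The block Wronskian identity `P_j Z_i′ - P_j′ Z_i` for `(i, j) = (1, 1)`, off the lattice. [folklore] -/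
theorem _root_.PeriodPair.wronskPZ_11 {z : ℂ} (hz : z ∉ L.lattice) :
    L.univExtP 1 z * L.univExtZ' 1 z - L.univExtP' 1 z * L.univExtZ 1 z =
      -(((1 / 4 : ℂ) * L.g₃) * (L.univExtP 0 z * L.univExtP 0 z)) + -(((1 / 4 : ℂ) * L.g₂) * (L.univExtP 0 z * L.univExtP 1 z)) + -(((1 / 4 : ℂ)) * (L.univExtP 2 z * L.univExtP 2 z)) := by
  obtain ⟨p0, p1, p2⟩ := L.univExtP_eq hz
  obtain ⟨-, z1, -⟩ := L.univExtZ_eq hz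
  obtain ⟨-, d1, -⟩ := L.univExtP'_eq hz
  obtain ⟨-, e1, -⟩ := L.univExtZ'_eq hz
  have hsq := L.derivWeierstrassP_sq z hz
  set S := L.weierstrassSigma z
  set T := L.weierstrassZeta z
  set WP := ℘[L] z
  set WQ := ℘'[L] z
  rw [p0, p1, p2, z1, d1, e1]
  linear_combination ((1 / 4 : ℂ) * S ^ 6) * hsq


/-- The block Wronskian identity `P_j Z_i′ - P_j′ Z_i` for `(i, j) = (1, 2)`, off the lattice. [folklore] -/
theorem _root_.PeriodPair.wronskPZ_12 {z : ℂ} (hz : z ∉ L.lattice) :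
    L.univExtP 2 z * L.univExtZ' 1 z - L.univExtP' 2 z * L.univExtZ 1 z =
      ((-3 / 2 : ℂ) * L.g₃) * (L.univExtZ 0 z * L.univExtP 0 z) + ((-1 / 2 : ℂ) * L.g₂) * (L.univExtZ 0 z * L.univExtP 1 z) + ((-1 / 2 : ℂ) * L.g₂) * (L.univExtZ 1 z * L.univExtP 0 z) + ((-1 / 2 : ℂ)) * (L.univExtZ 2 z * L.univExtP 2 z) := by
  obtain ⟨p0, p1, p2⟩ := L.univExtP_eq hz
  obtain ⟨z0, z1, z2⟩ := L.univExtZ_eq hz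
  obtain ⟨-, -, d2⟩ := L.univExtP'_eq hz
  obtain ⟨-, e1, -⟩ := L.univExtZ'_eq hz
  have hsq := L.derivWeierstrassP_sq z hz
  set S := L.weierstrassSigma z
  set T := L.weierstrassZeta z
  set WP := ℘[L] z
  set WQ := ℘'[L] z
  rw [p0, p1, p2, z0, z1, z2, d2, e1]
  linear_combination ((3 / 2 : ℂ) * S ^ 6 * T) * hsq


/-- The block Wronskian identity `P_j Z_i′ - P_j′ Z_i` for `(i, j) = (2, 0)`, off the lattice. [folklore] -/
theorem _root_.PeriodPair.wronskPZ_20 {z : ℂ} (hz : z ∉ L.lattice) :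
    L.univExtP 0 z * L.univExtZ' 2 z - L.univExtP' 0 z * L.univExtZ 2 z =
      ((-1 / 2 : ℂ) * L.g₂) * (L.univExtZ 0 z * L.univExtP 0 z) + ((6 : ℂ)) * (L.univExtZ 1 z * L.univExtP 1 z) + -(((-3 : ℂ)) * (L.univExtP 1 z * L.univExtP 2 z)) := by
  obtain ⟨p0, p1, p2⟩ := L.univExtP_eq hz
  obtain ⟨z0, z1, z2⟩ := L.univExtZ_eq hz
  obtain ⟨d0, -, -⟩ := L.univExtP'_eq hz
  obtain ⟨-, -, e2⟩ := L.univExtZ'_eq hz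
  have hsq := L.derivWeierstrassP_sq z hz
  set S := L.weierstrassSigma z
  set T := L.weierstrassZeta z
  set WP := ℘[L] z
  set WQ := ℘'[L] z
  rw [p0, p1, p2, z0, z1, z2, d0, e2]
  linear_combination (0) * hsq


/-- The block Wronskian identity `P_j Z_i′ - P_j′ Z_i` for `(i, j) = (2, 1)`, off the lattice. [folklore] -/
theorem _root_.PeriodPair.wronskPZ_21 {z : ℂ} (hz : z ∉ L.lattice) :
    L.univExtP 1 z * L.univExtZ' 2 z - L.univExtP' 1 z * L.univExtZ 2 z =
      ((3 / 2 : ℂ) * L.g₃) * (L.univExtZ 0 z * L.univExtP 0 z) + ((1 / 2 : ℂ) * L.g₂) * (L.univExtZ 0 z * L.univExtP 1 z) + ((1 / 2 : ℂ) * L.g₂) * (L.univExtZ 1 z * L.univExtP 0 z) + ((1 / 2 : ℂ)) * (L.univExtZ 2 z * L.univExtP 2 z) := by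
  obtain ⟨p0, p1, p2⟩ := L.univExtP_eq hz
  obtain ⟨z0, z1, z2⟩ := L.univExtZ_eq hz
  obtain ⟨-, d1, -⟩ := L.univExtP'_eq hz
  obtain ⟨-, -, e2⟩ := L.univExtZ'_eq hz
  have hsq := L.derivWeierstrassP_sq z hz
  set S := L.weierstrassSigma z
  set T := L.weierstrassZeta z
  set WP := ℘[L] z
  set WQ := ℘'[L] z
  rw [p0, p1, p2, z0, z1, z2, d1, e2]
  linear_combination ((-3 / 2 : ℂ) * S ^ 6 * T) * hsq


/-- The block Wronskian identity `P_j Z_i′ - P_j′ Z_i` for `(i, j) = (2, 2)`, off the lattice. [folklore] -/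
theorem _root_.PeriodPair.wronskPZ_22 {z : ℂ} (hz : z ∉ L.lattice) :
    L.univExtP 2 z * L.univExtZ' 2 z - L.univExtP' 2 z * L.univExtZ 2 z =
      -(((3 : ℂ) * L.g₃) * (L.univExtP 0 z * L.univExtP 1 z)) + -(((2 : ℂ) * L.g₂) * (L.univExtP 1 z * L.univExtP 1 z)) := by
  obtain ⟨p0, p1, p2⟩ := L.univExtP_eq hz
  obtain ⟨-, -, z2⟩ := L.univExtZ_eq hz
  obtain ⟨-, -, d2⟩ := L.univExtP'_eq hz
  obtain ⟨-, -, e2⟩ := L.univExtZ'_eq hz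
  have hsq := L.derivWeierstrassP_sq z hz
  set S := L.weierstrassSigma z
  set T := L.weierstrassZeta z
  set WP := ℘[L] z
  set WQ := ℘'[L] z
  rw [p0, p1, p2, z2, d2, e2]
  linear_combination ((3 : ℂ) * S ^ 6 * WP) * hsq


/-- The block Wronskian identity `Z_j Z_i′ - Z_i Z_j′` for `(i, j) = (0, 0)`, off the lattice. [folklore] -/
theorem _root_.PeriodPair.wronskZ_00 {z : ℂ} (hz : z ∉ L.lattice) :
    L.univExtZ 0 z * L.univExtZ' 0 z - L.univExtZ 0 z * L.univExtZ' 0 z =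
      -(((1 : ℂ)) * (L.univExtP 0 z * L.univExtZ 1 z)) + ((1 : ℂ)) * (L.univExtP 0 z * L.univExtZ 1 z) := by
  obtain ⟨p0, -, -⟩ := L.univExtP_eq hz
  obtain ⟨z0, z1, -⟩ := L.univExtZ_eq hz
  obtain ⟨e0, -, -⟩ := L.univExtZ'_eq hz
  have hsq := L.derivWeierstrassP_sq z hz
  set S := L.weierstrassSigma z
  set T := L.weierstrassZeta z
  set WP := ℘[L] z
  set WQ := ℘'[L] z
  rw [p0, z0, z1, e0]
  linear_combination (0) * hsq


/-- The block Wronskian identity `Z_j Z_i′ - Z_i Z_j′` for `(i, j) = (0, 1)`, off the lattice. [folklore] -/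
theorem _root_.PeriodPair.wronskZ_01 {z : ℂ} (hz : z ∉ L.lattice) :
    L.univExtZ 1 z * L.univExtZ' 0 z - L.univExtZ 0 z * L.univExtZ' 1 z =
      ((-1 / 2 : ℂ)) * (L.univExtZ 0 z * L.univExtZ 2 z) + ((-1 / 2 : ℂ)) * (L.univExtZ 2 z * L.univExtZ 0 z) + ((2 : ℂ)) * (L.univExtP 1 z * L.univExtZ 1 z) := by
  obtain ⟨-, p1, -⟩ := L.univExtP_eq hz
  obtain ⟨z0, z1, z2⟩ := L.univExtZ_eq hz
  obtain ⟨e0, e1, -⟩ := L.univExtZ'_eq hz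
  have hsq := L.derivWeierstrassP_sq z hz
  set S := L.weierstrassSigma z
  set T := L.weierstrassZeta z
  set WP := ℘[L] z
  set WQ := ℘'[L] z
  rw [p1, z0, z1, z2, e0, e1]
  linear_combination (0) * hsq


/-- The block Wronskian identity `Z_j Z_i′ - Z_i Z_j′` for `(i, j) = (0, 2)`, off the lattice. [folklore] -/
theorem _root_.PeriodPair.wronskZ_02 {z : ℂ} (hz : z ∉ L.lattice) :
    L.univExtZ 2 z * L.univExtZ' 0 z - L.univExtZ 0 z * L.univExtZ' 2 z =
      ((1 / 2 : ℂ) * L.g₂) * (L.univExtZ 0 z * L.univExtZ 0 z) + ((-6 : ℂ)) * (L.univExtZ 1 z * L.univExtZ 1 z) + -(((1 : ℂ)) * (L.univExtP 1 z * L.univExtZ 2 z)) + ((-3 : ℂ)) * (L.univExtP 1 z * L.univExtZ 2 z) + ((3 / 2 : ℂ) * L.g₃) * (L.univExtP 0 z * L.univExtP 0 z) + ((3 / 2 : ℂ) * L.g₂) * (L.univExtP 0 z * L.univExtP 1 z) + ((3 / 2 : ℂ)) * (L.univExtP 2 z * L.univExtP 2 z) := by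
  obtain ⟨p0, p1, p2⟩ := L.univExtP_eq hz
  obtain ⟨z0, z1, z2⟩ := L.univExtZ_eq hz
  obtain ⟨e0, -, e2⟩ := L.univExtZ'_eq hz
  have hsq := L.derivWeierstrassP_sq z hz
  set S := L.weierstrassSigma z
  set T := L.weierstrassZeta z
  set WP := ℘[L] z
  set WQ := ℘'[L] z
  rw [p0, p1, p2, z0, z1, z2, e0, e2]
  linear_combination ((-3 / 2 : ℂ) * S ^ 6) * hsq


/-- The block Wronskian identity `Z_j Z_i′ - Z_i Z_j′` for `(i, j) = (1, 0)`, off the lattice. [folklore] -/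
theorem _root_.PeriodPair.wronskZ_10 {z : ℂ} (hz : z ∉ L.lattice) :
    L.univExtZ 0 z * L.univExtZ' 1 z - L.univExtZ 1 z * L.univExtZ' 0 z =
      ((1 / 2 : ℂ)) * (L.univExtZ 0 z * L.univExtZ 2 z) + ((1 / 2 : ℂ)) * (L.univExtZ 2 z * L.univExtZ 0 z) + -(((2 : ℂ)) * (L.univExtP 1 z * L.univExtZ 1 z)) := by
  obtain ⟨-, p1, -⟩ := L.univExtP_eq hz
  obtain ⟨z0, z1, z2⟩ := L.univExtZ_eq hz
  obtain ⟨e0, e1, -⟩ := L.univExtZ'_eq hz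
  have hsq := L.derivWeierstrassP_sq z hz
  set S := L.weierstrassSigma z
  set T := L.weierstrassZeta z
  set WP := ℘[L] z
  set WQ := ℘'[L] z
  rw [p1, z0, z1, z2, e0, e1]
  linear_combination (0) * hsq


/-- The block Wronskian identity `Z_j Z_i′ - Z_i Z_j′` for `(i, j) = (1, 1)`, off the lattice. [folklore] -/
theorem _root_.PeriodPair.wronskZ_11 {z : ℂ} (hz : z ∉ L.lattice) :
    L.univExtZ 1 z * L.univExtZ' 1 z - L.univExtZ 1 z * L.univExtZ' 1 z =
      -(((1 / 4 : ℂ) * L.g₃) * (L.univExtP 0 z * L.univExtZ 0 z)) + -(((1 / 4 : ℂ) * L.g₂) * (L.univExtP 0 z * L.univExtZ 1 z)) + -(((1 / 4 : ℂ)) * (L.univExtP 2 z * L.univExtZ 2 z)) + ((1 / 4 : ℂ) * L.g₃) * (L.univExtP 0 z * L.univExtZ 0 z) + ((1 / 4 : ℂ) * L.g₂) * (L.univExtP 0 z * L.univExtZ 1 z) + ((1 / 4 : ℂ)) * (L.univExtP 2 z * L.univExtZ 2 z) := by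
  obtain ⟨p0, -, p2⟩ := L.univExtP_eq hz
  obtain ⟨z0, z1, z2⟩ := L.univExtZ_eq hz
  obtain ⟨-, e1, -⟩ := L.univExtZ'_eq hz
  have hsq := L.derivWeierstrassP_sq z hz
  set S := L.weierstrassSigma z
  set T := L.weierstrassZeta z
  set WP := ℘[L] z
  set WQ := ℘'[L] z
  rw [p0, p2, z0, z1, z2, e1]
  linear_combination (0) * hsq


/-- The block Wronskian identity `Z_j Z_i′ - Z_i Z_j′` for `(i, j) = (1, 2)`, off the lattice. [folklore] -/
theorem _root_.PeriodPair.wronskZ_12 {z : ℂ} (hz : z ∉ L.lattice) :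
    L.univExtZ 2 z * L.univExtZ' 1 z - L.univExtZ 1 z * L.univExtZ' 2 z =
      ((-3 / 2 : ℂ) * L.g₃) * (L.univExtZ 0 z * L.univExtZ 0 z) + ((-1 / 2 : ℂ) * L.g₂) * (L.univExtZ 0 z * L.univExtZ 1 z) + ((-1 / 2 : ℂ) * L.g₂) * (L.univExtZ 1 z * L.univExtZ 0 z) + ((-1 / 2 : ℂ)) * (L.univExtZ 2 z * L.univExtZ 2 z) := by
  obtain ⟨z0, z1, z2⟩ := L.univExtZ_eq hz
  obtain ⟨-, e1, e2⟩ := L.univExtZ'_eq hz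
  have hsq := L.derivWeierstrassP_sq z hz
  set S := L.weierstrassSigma z
  set T := L.weierstrassZeta z
  set WP := ℘[L] z
  set WQ := ℘'[L] z
  rw [z0, z1, z2, e1, e2]
  linear_combination ((3 / 2 : ℂ) * S ^ 6 * T ^ 2) * hsq


/-- The block Wronskian identity `Z_j Z_i′ - Z_i Z_j′` for `(i, j) = (2, 0)`, off the lattice. [folklore] -/
theorem _root_.PeriodPair.wronskZ_20 {z : ℂ} (hz : z ∉ L.lattice) :
    L.univExtZ 0 z * L.univExtZ' 2 z - L.univExtZ 2 z * L.univExtZ' 0 z =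
      ((-1 / 2 : ℂ) * L.g₂) * (L.univExtZ 0 z * L.univExtZ 0 z) + ((6 : ℂ)) * (L.univExtZ 1 z * L.univExtZ 1 z) + -(((-3 : ℂ)) * (L.univExtP 1 z * L.univExtZ 2 z)) + ((1 : ℂ)) * (L.univExtP 1 z * L.univExtZ 2 z) + ((-3 / 2 : ℂ) * L.g₃) * (L.univExtP 0 z * L.univExtP 0 z) + ((-3 / 2 : ℂ) * L.g₂) * (L.univExtP 0 z * L.univExtP 1 z) + ((-3 / 2 : ℂ)) * (L.univExtP 2 z * L.univExtP 2 z) := by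
  obtain ⟨p0, p1, p2⟩ := L.univExtP_eq hz
  obtain ⟨z0, z1, z2⟩ := L.univExtZ_eq hz
  obtain ⟨e0, -, e2⟩ := L.univExtZ'_eq hz
  have hsq := L.derivWeierstrassP_sq z hz
  set S := L.weierstrassSigma z
  set T := L.weierstrassZeta z
  set WP := ℘[L] z
  set WQ := ℘'[L] z
  rw [p0, p1, p2, z0, z1, z2, e0, e2]
  linear_combination ((3 / 2 : ℂ) * S ^ 6) * hsq


/-- The block Wronskian identity `Z_j Z_i′ - Z_i Z_j′` for `(i, j) = (2, 1)`, off the lattice. [folklore] -/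
theorem _root_.PeriodPair.wronskZ_21 {z : ℂ} (hz : z ∉ L.lattice) :
    L.univExtZ 1 z * L.univExtZ' 2 z - L.univExtZ 2 z * L.univExtZ' 1 z =
      ((3 / 2 : ℂ) * L.g₃) * (L.univExtZ 0 z * L.univExtZ 0 z) + ((1 / 2 : ℂ) * L.g₂) * (L.univExtZ 0 z * L.univExtZ 1 z) + ((1 / 2 : ℂ) * L.g₂) * (L.univExtZ 1 z * L.univExtZ 0 z) + ((1 / 2 : ℂ)) * (L.univExtZ 2 z * L.univExtZ 2 z) := by
  obtain ⟨z0, z1, z2⟩ := L.univExtZ_eq hz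
  obtain ⟨-, e1, e2⟩ := L.univExtZ'_eq hz
  have hsq := L.derivWeierstrassP_sq z hz
  set S := L.weierstrassSigma z
  set T := L.weierstrassZeta z
  set WP := ℘[L] z
  set WQ := ℘'[L] z
  rw [z0, z1, z2, e1, e2]
  linear_combination ((-3 / 2 : ℂ) * S ^ 6 * T ^ 2) * hsq


/-- The block Wronskian identity `Z_j Z_i′ - Z_i Z_j′` for `(i, j) = (2, 2)`, off the lattice. [folklore] -/
theorem _root_.PeriodPair.wronskZ_22 {z : ℂ} (hz : z ∉ L.lattice) :
    L.univExtZ 2 z * L.univExtZ' 2 z - L.univExtZ 2 z * L.univExtZ' 2 z =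
      -(((3 : ℂ) * L.g₃) * (L.univExtP 0 z * L.univExtZ 1 z)) + -(((2 : ℂ) * L.g₂) * (L.univExtP 1 z * L.univExtZ 1 z)) + ((3 : ℂ) * L.g₃) * (L.univExtP 0 z * L.univExtZ 1 z) + ((2 : ℂ) * L.g₂) * (L.univExtP 1 z * L.univExtZ 1 z) := by
  obtain ⟨p0, p1, -⟩ := L.univExtP_eq hz
  obtain ⟨-, z1, z2⟩ := L.univExtZ_eq hz
  obtain ⟨-, -, e2⟩ := L.univExtZ'_eq hz
  have hsq := L.derivWeierstrassP_sq z hz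
  set S := L.weierstrassSigma z
  set T := L.weierstrassZeta z
  set WP := ℘[L] z
  set WQ := ℘'[L] z
  rw [p0, p1, z1, z2, e2]
  linear_combination (0) * hsq

end Literature.NumberTheory.Transcendental

end
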